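import Mathlib
import Summits.KontsevichZagierPeriods.Zeta5Search.BrickTwistedHarmonicLawsTwo
import Summits.KontsevichZagierPeriods.Zeta5Search.BrickPropositionHTwo

/-!
# BrickTwistedHarmonicTwo — PROPOSITION H at the prime `2` for the `C`-TWISTED HARMONIC CELLS
`Z̃^{(w,C)}_K(M) = Σ_s w_s·c̃_{K,s}(M)·H_K^{(s+C)}` of the centre-free brick kernel: for `A` even, `1 ≤ B`, `2B ≤ A`, every level `ℓ`,
every row `M < 2^{ℓ+1}` and every 2-admissible weight `g`, `v₂(Σ_{k≤M} g(k)·2^{ℓ(A+C)}·Z̃^{(w,C)}_k(M)) ≤ exp(−ℓ)`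
(cell `pub-zeta5`, seat ct-1 g45; the twisted form of the harmonic clause of ct-1 g43's `BrickPropositionHTwo.propositionH_two`)

HONEST FRAMING: systematic search; no irrationality claim unless certified.  `2`-ADIC BOOKKEEPING (`w` any `2`-integral weights,
`C ≥ 0`; the twisted cell is written out in full, no definition); nothing about `ζ(5)`; no `γ` / record statement; records in print
UNMOVED; NOTHING IS DISCHARGED.  Theorems only (0 `def`).  The induction is ct-1 g43's: the ° cells descend with `W = 2ω`, the holes
with `G = 2^Aγ` (`BrickWeightDescentTwo`, `BrickBlockWeightTwo` — the weight laws do not see the twist), the one-level reductions are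
ct-1 g45's `BrickTwistedHarmonicLawsTwo.level_reduction_two_odd/even_twist`; base `M ≤ 1` by one-digit integrality.  NOT sharpened (no
extra factor `2`: as for `C = 0`, Krattenthaler–Rivoal's printed `2` is genuine at even `C`).  CONSUMER: ct-1 g45's
`BrickDenominatorsAllCTwo` — Krattenthaler–Rivoal's Théorème 1 (ii) for `r = 1`, `A` even, EVERY `C`, at the prime `2`.

* `level_step_two_odd_twist`, `level_step_two_even_twist` — the induction steps (rows `2N+1`, `2N+2`);
* **`propositionH_two_twist`** — the statement above; `propositionH_two_twist_linear` — the weight `n − 2k`.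
-/

namespace Summit.KontsevichZagierPeriods.Zeta5Search.BrickTwistedHarmonicTwo

open Finset Nat WithZero
open Summit.KontsevichZagierPeriods.Zeta5Search.BrickLaurent (cell)
open Summit.KontsevichZagierPeriods.Zeta5Search.BrickHarmonicBlocks (hsum)
open Summit.KontsevichZagierPeriods.Zeta5Search.BrickLevelReduction (blockWeight)
open Summit.KontsevichZagierPeriods.Zeta5Search.BrickHoleWeight (holeWeight)
open Summit.KontsevichZagierPeriods.Zeta5Search.BrickDigitSideZero (hsum_integral_of_lt)
open Summit.KontsevichZagierPeriods.Zeta5Search.BrickCellsAllPrimes (cell_zero_integral_of_lt)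
open Summit.KontsevichZagierPeriods.Zeta5Search.BrickResidueLawTwo (padicValuation_two padicValuation_two_pow)
open Summit.KontsevichZagierPeriods.Zeta5Search.BrickTwistedHarmonicLawsTwo (level_reduction_two_odd_twist
  level_reduction_two_even_twist)
open Summit.KontsevichZagierPeriods.Zeta5Search.BrickBlockWeightTwo (blockWeight_two_odd_le padicValuation_blockWeight_two_even
  holeWeight_two_le)
open Summit.KontsevichZagierPeriods.Zeta5Search.BrickWeightDescentTwo (padicValuation_natCast_sub_le blockWeight_two_odd_reflect
  blockWeight_two_odd_local even_row_le blockWeight_two_even_reflect blockWeight_two_even_local holeWeight_two_reflect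
  holeWeight_two_local)
open Summit.KontsevichZagierPeriods.Zeta5Search.BrickPropositionHTwo (padicValuation_div_two_pow_le sum_pow_mul)

noncomputable section

/-! ## The induction step -/

section step

variable {A B L : ℕ} (hA : Even A) (hB : 1 ≤ B) (hAB : 2 * B ≤ A) {C : ℕ} {w : ℕ → ℚ} (hw : ∀ s, Rat.padicValuation 2 (w s) ≤ 1)
  (IH : ∀ M, M < 2 ^ (L + 1) → ∀ g' : ℕ → ℚ, (∀ K, K ≤ M → Rat.padicValuation 2 (g' K) ≤ 1) →
    (∀ K, K ≤ M → g' (M - K) + g' K = 0) →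
    (∀ e K K', e ≤ L → K ≤ M → K' ≤ M → (2 : ℤ) ^ e ∣ (K : ℤ) - K' →
      Rat.padicValuation 2 (g' K' - g' K) ≤ exp (-((e : ℤ) + 1))) →
    Rat.padicValuation 2 (∑ K ∈ range (M + 1), g' K * ((2 : ℚ) ^ (L * (A + C)) *
      ∑ s ∈ Icc 1 A, w s * (cell A B 0 M K s * hsum (s + C) K))) ≤ exp (-(L : ℤ)))
include hA hB hAB hw IH

/-- **The step on an ODD row `2N+1`** (`N < 2^{L+1}`, `g` 2-admissible at level `L+1`): `W = 2ω` on the row `N`. -/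
theorem level_step_two_odd_twist {N : ℕ} (hN : N < 2 ^ (L + 1)) {g : ℕ → ℚ}
    (hgI : ∀ k, k ≤ 2 * N + 1 → Rat.padicValuation 2 (g k) ≤ 1)
    (hgS : ∀ k, k ≤ 2 * N + 1 → g (2 * N + 1 - k) + g k = 0)
    (hgD : ∀ e k k', e ≤ L + 1 → k ≤ 2 * N + 1 → k' ≤ 2 * N + 1 → (2 : ℤ) ^ e ∣ (k : ℤ) - k' →
      Rat.padicValuation 2 (g k' - g k) ≤ exp (-((e : ℤ) + 1))) :
    Rat.padicValuation 2 (∑ k ∈ range (2 * N + 1 + 1), g k * ((2 : ℚ) ^ ((L + 1) * (A + C)) *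
      ∑ s ∈ Icc 1 A, w s * (cell A B 0 (2 * N + 1) k s * hsum (s + C) k))) ≤ exp (-((L : ℤ) + 1)) := by
  set W : ℕ → ℚ := blockWeight A B 0 2 1 N g with hW
  set ω : ℕ → ℚ := fun K => W K / 2 with hω
  have hWω : ∀ K, W K = (2 : ℚ) ^ 1 * ω K := fun K => by rw [hω]; simp only; rw [pow_one, mul_div_cancel₀ _ two_ne_zero]
  have hωI : ∀ K, K ≤ N → Rat.padicValuation 2 (ω K) ≤ 1 := fun K hK => by
    have h := padicValuation_div_two_pow_le 1
      (blockWeight_two_odd_le hAB hK (hgI (2 * K) (by omega)) (hgI (2 * K + 1) (by omega)))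
    rw [pow_one] at h
    exact h.trans (by rw [← exp_zero, exp_le_exp]; push_cast; omega)
  have hωS : ∀ K, K ≤ N → ω (N - K) + ω K = 0 := fun K hK => by
    rw [hω]; simp only; rw [← add_div, hW, blockWeight_two_odd_reflect hA hgS hK, zero_div]
  have hωD : ∀ e K K', e ≤ L → K ≤ N → K' ≤ N → (2 : ℤ) ^ e ∣ (K : ℤ) - K' →
      Rat.padicValuation 2 (ω K' - ω K) ≤ exp (-((e : ℤ) + 1)) := fun e K K' he hK hK' hdvd => by
    rw [hω]; simp only; rw [← sub_div]
    have h := padicValuation_div_two_pow_le 1 (blockWeight_two_odd_local hA hB hAB hgI hgS hgD he hK hK' hdvd)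
    rw [pow_one] at h
    exact h.trans (by rw [exp_le_exp]; push_cast; omega)
  have IH0 := IH N hN ω hωI hωS hωD
  have hred := level_reduction_two_odd_twist hAB hB hN hgI (C := C) hw
  have hmain : Rat.padicValuation 2 (∑ K ∈ range (N + 1), blockWeight A B 0 2 1 N g K * ((2 : ℚ) ^ (L * (A + C)) *
      ∑ s ∈ Icc 1 A, w s * (cell A B 0 N K s * hsum (s + C) K))) ≤ exp (-((L : ℤ) + 1)) := by
    rw [← hW, show ∑ K ∈ range (N + 1), W K * ((2 : ℚ) ^ (L * (A + C)) *
        ∑ s ∈ Icc 1 A, w s * (cell A B 0 N K s * hsum (s + C) K)) =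
      ∑ K ∈ range (N + 1), ((2 : ℚ) ^ 1 * ω K) * ((2 : ℚ) ^ (L * (A + C)) *
        ∑ s ∈ Icc 1 A, w s * (cell A B 0 N K s * hsum (s + C) K)) from
        Finset.sum_congr rfl fun K _ => by rw [hWω K], sum_pow_mul, map_mul, padicValuation_two_pow]
    calc _ ≤ exp (-((1 : ℕ) : ℤ)) * exp (-(L : ℤ)) := mul_le_mul' le_rfl IH0
      _ = _ := by rw [← exp_add]; congr 1; push_cast; ring
  have h := Valuation.map_add_le _ hred hmain
  rwa [sub_add_cancel] at h

/-- **The step on an EVEN row `2N+2`** (`N + 1 < 2^{L+1}`, `g` 2-admissible at level `L+1`): `W = 2ω` on the row `N+1`, `G = 2^Aγ` on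
the row `N` (`A ≥ 2` absorbs the holes). -/
theorem level_step_two_even_twist {N : ℕ} (hN : N + 1 < 2 ^ (L + 1)) {g : ℕ → ℚ}
    (hgI : ∀ k, k ≤ 2 * N + 2 → Rat.padicValuation 2 (g k) ≤ 1)
    (hgS : ∀ k, k ≤ 2 * N + 2 → g (2 * N + 2 - k) + g k = 0)
    (hgD : ∀ e k k', e ≤ L + 1 → k ≤ 2 * N + 2 → k' ≤ 2 * N + 2 → (2 : ℤ) ^ e ∣ (k : ℤ) - k' →
      Rat.padicValuation 2 (g k' - g k) ≤ exp (-((e : ℤ) + 1))) :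
    Rat.padicValuation 2 (∑ k ∈ range (2 * N + 2 + 1), g k * ((2 : ℚ) ^ ((L + 1) * (A + C)) *
      ∑ s ∈ Icc 1 A, w s * (cell A B 0 (2 * N + 2) k s * hsum (s + C) k))) ≤ exp (-((L : ℤ) + 1)) := by
  have hA1 : 1 ≤ A := by omega
  have hN' : N < 2 ^ (L + 1) := by omega
  set W : ℕ → ℚ := blockWeight A B 0 2 0 (N + 1) g with hW
  set ω : ℕ → ℚ := fun K => W K / 2 with hω
  have hWω : ∀ K, W K = (2 : ℚ) ^ 1 * ω K := fun K => by rw [hω]; simp only; rw [pow_one, mul_div_cancel₀ _ two_ne_zero]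
  have hωI : ∀ K, K ≤ N + 1 → Rat.padicValuation 2 (ω K) ≤ 1 := fun K hK => by
    have hWK : Rat.padicValuation 2 (W K) ≤ exp (-1 : ℤ) := by
      rw [hW, padicValuation_blockWeight_two_even hAB hK]; exact even_row_le hgS hgD (by omega)
    have h := padicValuation_div_two_pow_le 1 hWK
    rw [pow_one] at h
    exact h.trans (by rw [← exp_zero, exp_le_exp]; norm_num)
  have hωS : ∀ K, K ≤ N + 1 → ω (N + 1 - K) + ω K = 0 := fun K hK => by
    rw [hω]; simp only; rw [← add_div, hW, blockWeight_two_even_reflect hA hAB hgS hK, zero_div]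
  have hωD : ∀ e K K', e ≤ L → K ≤ N + 1 → K' ≤ N + 1 → (2 : ℤ) ^ e ∣ (K : ℤ) - K' →
      Rat.padicValuation 2 (ω K' - ω K) ≤ exp (-((e : ℤ) + 1)) := fun e K K' he hK hK' hdvd => by
    rw [hω]; simp only; rw [← sub_div]
    have h := padicValuation_div_two_pow_le 1 (blockWeight_two_even_local hAB hgS hgD he hK hK' hdvd)
    rw [pow_one] at h
    exact h.trans (by rw [exp_le_exp]; push_cast; omega)
  have IH0 := IH (N + 1) hN ω hωI hωS hωD
  set G : ℕ → ℚ := holeWeight A B 0 2 0 N g with hG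
  set γ : ℕ → ℚ := fun K => G K / (2 : ℚ) ^ A with hγ
  have hGγ : ∀ K, G K = (2 : ℚ) ^ A * γ K := fun K => by
    rw [hγ]; simp only; rw [mul_div_cancel₀ _ (pow_ne_zero A two_ne_zero)]
  have hγI : ∀ K, K ≤ N → Rat.padicValuation 2 (γ K) ≤ 1 := fun K hK => by
    have h := padicValuation_div_two_pow_le A (holeWeight_two_le hAB hK (hgI (2 * K + 1) (by omega)))
    rw [neg_add_cancel, exp_zero] at h
    simpa only [hγ, hG] using h
  have hγS : ∀ K, K ≤ N → γ (N - K) + γ K = 0 := fun K hK => by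
    rw [hγ]; simp only; rw [← add_div, hG, holeWeight_two_reflect hA hgS hK, zero_div]
  have hγD : ∀ e K K', e ≤ L → K ≤ N → K' ≤ N → (2 : ℤ) ^ e ∣ (K : ℤ) - K' →
      Rat.padicValuation 2 (γ K' - γ K) ≤ exp (-((e : ℤ) + 1)) := fun e K K' he hK hK' hdvd => by
    rw [hγ]; simp only; rw [← sub_div]
    have h := padicValuation_div_two_pow_le A (holeWeight_two_local hAB hgS hgD he hK hK' hdvd)
    exact h.trans (by rw [exp_le_exp]; omega)
  have H0 := IH N hN' γ hγI hγS hγD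
  have hred := level_reduction_two_even_twist hAB hN hgI (C := C) hw hA1
  have hmain : Rat.padicValuation 2 (∑ K ∈ range (N + 1 + 1), blockWeight A B 0 2 0 (N + 1) g K * ((2 : ℚ) ^ (L * (A + C)) *
      ∑ s ∈ Icc 1 A, w s * (cell A B 0 (N + 1) K s * hsum (s + C) K))) ≤ exp (-((L : ℤ) + 1)) := by
    rw [← hW, show ∑ K ∈ range (N + 1 + 1), W K * ((2 : ℚ) ^ (L * (A + C)) *
        ∑ s ∈ Icc 1 A, w s * (cell A B 0 (N + 1) K s * hsum (s + C) K)) =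
      ∑ K ∈ range (N + 1 + 1), ((2 : ℚ) ^ 1 * ω K) * ((2 : ℚ) ^ (L * (A + C)) *
        ∑ s ∈ Icc 1 A, w s * (cell A B 0 (N + 1) K s * hsum (s + C) K)) from
        Finset.sum_congr rfl fun K _ => by rw [hWω K], sum_pow_mul, map_mul, padicValuation_two_pow]
    calc _ ≤ exp (-((1 : ℕ) : ℤ)) * exp (-(L : ℤ)) := mul_le_mul' le_rfl IH0
      _ = _ := by rw [← exp_add]; congr 1; push_cast; ring
  have hhole : Rat.padicValuation 2 (∑ K ∈ range (N + 1), holeWeight A B 0 2 0 N g K * ((2 : ℚ) ^ (L * (A + C)) *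
      ∑ s ∈ Icc 1 A, w s * (cell A B 0 N K s * hsum (s + C) K))) ≤ exp (-((L : ℤ) + 1)) := by
    rw [← hG, show ∑ K ∈ range (N + 1), G K * ((2 : ℚ) ^ (L * (A + C)) *
        ∑ s ∈ Icc 1 A, w s * (cell A B 0 N K s * hsum (s + C) K)) =
      ∑ K ∈ range (N + 1), ((2 : ℚ) ^ A * γ K) * ((2 : ℚ) ^ (L * (A + C)) *
        ∑ s ∈ Icc 1 A, w s * (cell A B 0 N K s * hsum (s + C) K)) from
        Finset.sum_congr rfl fun K _ => by rw [hGγ K], sum_pow_mul, map_mul, padicValuation_two_pow]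
    calc _ ≤ exp (-(A : ℤ)) * exp (-(L : ℤ)) := mul_le_mul' le_rfl H0
      _ ≤ _ := by rw [← exp_add, exp_le_exp]; omega
  have h := Valuation.map_add_le _ (Valuation.map_add_le _ hred hhole) hmain
  rwa [sub_add_cancel, sub_add_cancel] at h

end step

/-! ## PROPOSITION H at `2` for the twisted harmonic cell -/

/-- **PROPOSITION H at `p = 2` FOR THE TWISTED HARMONIC CELL.**  For `A` even, `1 ≤ B`, `2B ≤ A`, any shift `C`, any `2`-integral
weights `w`, EVERY level `ℓ`, every row `M < 2^{ℓ+1}` and every weight `g` that is 2-ADMISSIBLE at level `ℓ` ((I), (S) exact,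
(D⁺)): `v₂(Σ_{k≤M} g(k)·2^{ℓ(A+C)}·Σ_s w_s·c̃_{k,s}(M)·H_k^{(s+C)}) ≤ exp(−ℓ)`.  At `w ≡ 1`, `C = 0` this is the harmonic clause of
ct-1 g43's `BrickPropositionHTwo.propositionH_two` (up to the sign of `cellZero`). -/
theorem propositionH_two_twist {A B : ℕ} (hA : Even A) (hB : 1 ≤ B) (hAB : 2 * B ≤ A) {C : ℕ} {w : ℕ → ℚ}
    (hw : ∀ s, Rat.padicValuation 2 (w s) ≤ 1) :
    ∀ ℓ : ℕ, ∀ M : ℕ, M < 2 ^ (ℓ + 1) → ∀ g : ℕ → ℚ, (∀ k, k ≤ M → Rat.padicValuation 2 (g k) ≤ 1) →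
      (∀ k, k ≤ M → g (M - k) + g k = 0) →
      (∀ e k k', e ≤ ℓ → k ≤ M → k' ≤ M → (2 : ℤ) ^ e ∣ (k : ℤ) - k' →
        Rat.padicValuation 2 (g k' - g k) ≤ exp (-((e : ℤ) + 1))) →
      Rat.padicValuation 2 (∑ k ∈ range (M + 1), g k * ((2 : ℚ) ^ (ℓ * (A + C)) *
        ∑ s ∈ Icc 1 A, w s * (cell A B 0 M k s * hsum (s + C) k))) ≤ exp (-(ℓ : ℤ)) := by
  intro ℓ
  induction ℓ with
  | zero =>
    intro M hM g hgI _ _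
    rw [zero_add, pow_one] at hM
    simp only [Nat.cast_zero, neg_zero, exp_zero, zero_mul, pow_zero, one_mul]
    refine Valuation.map_sum_le _ fun k hk => ?_
    have hk' : k ≤ M := by have := mem_range.1 hk; omega
    rw [map_mul]
    refine mul_le_one' (hgI k hk') (Valuation.map_sum_le _ fun s _ => ?_)
    rw [map_mul, map_mul]
    exact mul_le_one' (hw s) (mul_le_one' (cell_zero_integral_of_lt hAB hM hk' s) (hsum_integral_of_lt (by omega) (s + C)))
  | succ L ih =>
    intro M hM g hgI hgS hgD
    have hpow : 2 ^ (L + 1 + 1) = 2 * 2 ^ (L + 1) := by rw [pow_succ]; ring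
    rcases Nat.even_or_odd' M with ⟨N, hMN | hMN⟩
    · rcases N with _ | N
      · obtain rfl : M = 0 := by omega
        have h0 : g 0 = 0 := by have h := hgS 0 le_rfl; rw [Nat.sub_zero] at h; linarith
        simp only [zero_add, Finset.sum_range_one, h0, zero_mul, map_zero]
        exact _root_.zero_le
      · obtain rfl : M = 2 * N + 2 := by omega
        have hN : N + 1 < 2 ^ (L + 1) := by omega
        have h := level_step_two_even_twist hA hB hAB hw (fun M' hM' g' h1 h2 h3 => ih M' hM' g' h1 h2 h3) hN hgI hgS hgD
        exact_mod_cast h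
    · subst hMN
      have hN : N < 2 ^ (L + 1) := by omega
      have h := level_step_two_odd_twist hA hB hAB hw (fun M' hM' g' h1 h2 h3 => ih M' hM' g' h1 h2 h3) hN hgI hgS hgD
      exact_mod_cast h

/-- **The weight `n − 2k`**: for `A` even, `1 ≤ B`, `2B ≤ A`, every `ℓ`, `n < 2^{ℓ+1}`, every `C` and `2`-integral `w`:
`v₂(Σ_{k≤n} (n−2k)·2^{ℓ(A+C)}·Z̃^{(w,C)}_k(n)) ≤ exp(−ℓ)`. -/
theorem propositionH_two_twist_linear {A B : ℕ} (hA : Even A) (hB : 1 ≤ B) (hAB : 2 * B ≤ A) {C : ℕ} {w : ℕ → ℚ}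
    (hw : ∀ s, Rat.padicValuation 2 (w s) ≤ 1) (ℓ n : ℕ) (hn : n < 2 ^ (ℓ + 1)) :
    Rat.padicValuation 2 (∑ k ∈ range (n + 1), ((n : ℚ) - 2 * k) * ((2 : ℚ) ^ (ℓ * (A + C)) *
      ∑ s ∈ Icc 1 A, w s * (cell A B 0 n k s * hsum (s + C) k))) ≤ exp (-(ℓ : ℤ)) := by
  refine propositionH_two_twist hA hB hAB hw ℓ n hn (fun k => (n : ℚ) - 2 * k) (fun k _ => ?_) (fun k hk => ?_)
    (fun e k k' _ _ _ hdvd => ?_)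
  · rw [show (n : ℚ) - 2 * k = (((n : ℤ) - 2 * k : ℤ) : ℚ) by push_cast; ring, Rat.padicValuation_cast]
    exact Int.padicValuation_le_one _ _
  · push_cast [Nat.cast_sub hk]; ring
  · rw [show ((n : ℚ) - 2 * k') - ((n : ℚ) - 2 * k) = 2 * ((k : ℚ) - k') by ring, map_mul, padicValuation_two]
    calc _ ≤ exp (-1 : ℤ) * exp (-(e : ℤ)) := mul_le_mul' le_rfl (padicValuation_natCast_sub_le hdvd)
      _ = _ := by rw [← exp_add]; congr 1; ring

end

end Summit.KontsevichZagierPeriods.Zeta5Search.BrickTwistedHarmonicTwo
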